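import Literature.MathematicalPhysics.QuantumFieldTheory.Balaban1983to89.T3CentreSymmetrySUN
import HarnessLib

/-!
# `Balaban1983to89.T3PolyakovCovariance` — rung R3: the Polyakov-loop margin and NT3 for EVERY Polyakov label (any direction, any base
# point), by the lattice covariance of the Wilson expectations at every cutoff

CITATION HEADER (lean-in-tree rule).  Cell `ym3-torus` (HUMAN RULING D-0037, YM ladder rung R3), seat `ym3-torus-p2` gen 6 (HOME/IR-NODE.md §12).
Sources: T. Bałaban, CMP **109** (1987) [Balaban1987RG1] (2.17) p. 269 (the block averaging (0.4) commutes with lattice translations and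
coordinate permutations; tree `T3CovarianceRP.avgObs_translate/avgObs_permute`, `TorusScheme.expectAt_map_eq_of_translate/_permute`);
C. Borgs, E. Seiler, CMP **91** (1983) [BorgsSeiler1983] §III.1 (III.23) p. 347; S. Chatterjee in Friz et al. (eds.) 2019
[Chatterjee2019YMProbabilists] §6 p. 19.

WHAT IS PROVED.  The files `T3PolyakovVariance`, `T3TailTransferLower`, `T3CentreSymmetrySUN` state the margin `⟨W̄_P W̄_P⟩₀ ≥ 1/4`
(`SU(2)`; `1/(2N²)` for `SU(N)`, `N ≥ 3`) and the NT3 reductions for the TEMPORAL Polyakov label through a base point in the reflection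
hyperplane `t = 0` (where Osterwalder–Seiler positivity splits the loop).  Here: **`exists_canonical_polyakov`** — for every direction `μ` and
base point `x` there is a base point `y` with `y 0 = 0` such that, at EVERY cutoff `K`, every coupling and every small-loop average, the
joint expectations of any string of copies of `polyakov μ x` equal those of `polyakov 0 y` (coordinate permutation `0 ↔ μ`, then a unit
translation; both exact symmetries of the `K`-th Wilson expectation intertwined with the averaging, [Balaban1987RG1] (2.17)); hence
`exists_uniformVariance_polyakov_iff`, and the margin / NT3 statements for ALL Polyakov labels: `expectAt_zero_polyakov_pair_ge_all`
(`SU(2)`: `1/4 ≤ ⟨W̄_P W̄_P⟩₀`), `uniformVariance_polyakov_of_smallMass_all` (`SU(2)`), `uniformVariance_polyakov_of_smallMass_SU_all`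
(`SU(N)`, `N ≥ 3`).  WHAT THIS IS NOT: no new estimate — relabelling bookkeeping only.
-/

noncomputable section

open MeasureTheory Filter Topology
open Literature.MathematicalPhysics.QuantumFieldTheory.Balaban1983to89.T4Continuum
open Literature.MathematicalPhysics.QuantumFieldTheory.Balaban1983to89.T3ContinuumYM3Torus
open Literature.MathematicalPhysics.QuantumFieldTheory.Balaban1983to89.T3UnitScaleTilt
open Literature.MathematicalPhysics.QuantumFieldTheory.Balaban1983to89.T3PolyakovVariance
open Literature.MathematicalPhysics.QuantumFieldTheory.Balaban1983to89.T3TailTransferLower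
open Literature.MathematicalPhysics.QuantumFieldTheory.Balaban1983to89.T3CentreSymmetrySUN

namespace Literature.MathematicalPhysics.QuantumFieldTheory.Balaban1983to89.T3PolyakovCovariance

/-! ## 1. Relabelling the Polyakov label: translations and coordinate permutations -/

section Labels

variable {F : T3Family}

/-- Translating the Polyakov label translates its base point. [cite: Balaban1987RG1, (2.17) p.269] -/
theorem polyakov_translate (μ : Fin 3) (x a : F.USite) :
    (ULoop3.polyakov μ x).translate a = ULoop3.polyakov μ (x + a) := rfl

/-- Permuting coordinates maps the Polyakov label in direction `μ` to the one in direction `π μ` through the permuted base point. [cite: Balaban1987RG1, (2.17) p.269] -/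
theorem polyakov_permute (π : Equiv.Perm (Fin 3)) (μ : Fin 3) (x : F.USite) :
    (ULoop3.polyakov μ x).permute π = ULoop3.polyakov (π μ) (Site.permute π x) := by
  apply Subtype.ext
  show (⟨Site.permute π x, (List.replicate (2 * F.L ^ F.m) (μ, true)).map (Letter.permute π)⟩ : UWord3 F) =
    ⟨Site.permute π x, List.replicate (2 * F.L ^ F.m) (π μ, true)⟩
  rw [List.map_replicate]
  rfl

end Labels

/-! ## 2. Every Polyakov label has the joint expectations of a temporal one through the hyperplane `t = 0` -/

section Canonical

variable (F : T3Family) {G : Type*} [GaugeGroup G] [MeasurableSpace G] [HaarData G] (ℰ : LoopAverage G) (γ : ℝ)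

/-- Strings of copies of a translated label have the same joint expectations at every cutoff. [cite: Balaban1987RG1, (2.17) p.269] -/
theorem expectAt_replicate_translate (a : F.USite) (K n : ℕ) (C : ULoop3 F) :
    (F.scheme ℰ γ).expectAt K (List.replicate n (C.translate a)) = (F.scheme ℰ γ).expectAt K (List.replicate n C) := by
  rw [← List.map_replicate]
  exact (F.scheme ℰ γ).expectAt_map_eq_of_translate (ULoop3.translate a)
    (fun K => ⟨Site.scaleTo K (F.toLevel K a), fun C => funext fun U => F.avgObs_translate ℰ K a C U⟩) K _

/-- Strings of copies of a permuted label have the same joint expectations at every cutoff. [cite: Balaban1987RG1, (2.17) p.269] -/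
theorem expectAt_replicate_permute (π : Equiv.Perm (Fin 3)) (K n : ℕ) (C : ULoop3 F) :
    (F.scheme ℰ γ).expectAt K (List.replicate n (C.permute π)) = (F.scheme ℰ γ).expectAt K (List.replicate n C) := by
  rw [← List.map_replicate]
  exact (F.scheme ℰ γ).expectAt_map_eq_of_permute (ULoop3.permute π)
    (fun K => ⟨π, fun C => funext fun U => F.avgObs_permute ℰ K π C U⟩) K _

/-- **EVERY POLYAKOV LABEL IS EQUIVALENT TO A TEMPORAL ONE THROUGH THE HYPERPLANE `t = 0`**: for every direction `μ` and base point `x`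
there is `y` with `y 0 = 0` such that `⟨W̄_{P(μ,x)}^{n}⟩_K = ⟨W̄_{P(0,y)}^{n}⟩_K` for every `K`, every `n` (every `G`, `ℰ`, `γ`). [cite: Balaban1987RG1, (2.17) p.269] -/
theorem exists_canonical_polyakov (μ : Fin 3) (x : F.USite) : ∃ y : F.USite, y 0 = 0 ∧ ∀ K n : ℕ,
    (F.scheme ℰ γ).expectAt K (List.replicate n (ULoop3.polyakov μ x)) =
      (F.scheme ℰ γ).expectAt K (List.replicate n (ULoop3.polyakov 0 y)) := by
  set π : Equiv.Perm (Fin 3) := Equiv.swap 0 μ with hπ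
  set x' : F.USite := Site.permute π x with hx'
  set y : F.USite := Function.update x' 0 0 with hy
  refine ⟨y, Function.update_self .., fun K n => ?_⟩
  have h1 : (F.scheme ℰ γ).expectAt K (List.replicate n ((ULoop3.polyakov μ x).permute π)) =
      (F.scheme ℰ γ).expectAt K (List.replicate n (ULoop3.polyakov μ x)) := expectAt_replicate_permute F ℰ γ π K n _
  rw [polyakov_permute, hπ, Equiv.swap_apply_right] at h1
  have h2 : (F.scheme ℰ γ).expectAt K (List.replicate n ((ULoop3.polyakov 0 y).translate (x' - y))) =
      (F.scheme ℰ γ).expectAt K (List.replicate n (ULoop3.polyakov 0 y)) := expectAt_replicate_translate F ℰ γ _ K n _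
  rw [polyakov_translate, add_sub_cancel] at h2
  rw [← h1, ← h2]

variable {F ℰ γ}

/-- The binder `UniformVariance` depends on the label only through its one- and two-point expectations at every cutoff. [cite: Chatterjee2019YMProbabilists, §6 p.19] -/
theorem uniformVariance_congr {O : Type*} {S : Missing.TorusScheme G O} {o o' : O} {c : ℝ}
    (h1 : ∀ K, S.expectAt K [o] = S.expectAt K [o']) (h2 : ∀ K, S.expectAt K [o, o] = S.expectAt K [o', o']) :
    UniformVariance S o c ↔ UniformVariance S o' c := by
  simp only [UniformVariance, h1, h2]

/-- **NT3 FOR ANY POLYAKOV LABEL ⇔ NT3 FOR A CANONICAL ONE**: `UniformVariance (F.scheme ℰ γ) (polyakov μ x) c ↔ UniformVariance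
(F.scheme ℰ γ) (polyakov 0 y) c` for the `y` of `exists_canonical_polyakov`. [cite: Chatterjee2019YMProbabilists, §6 p.19] -/
theorem exists_uniformVariance_polyakov_iff (μ : Fin 3) (x : F.USite) : ∃ y : F.USite, y 0 = 0 ∧
    (∀ K, (F.scheme ℰ γ).expectAt K [ULoop3.polyakov μ x, ULoop3.polyakov μ x] =
      (F.scheme ℰ γ).expectAt K [ULoop3.polyakov 0 y, ULoop3.polyakov 0 y]) ∧
    ∀ c : ℝ, UniformVariance (F.scheme ℰ γ) (ULoop3.polyakov μ x) c ↔ UniformVariance (F.scheme ℰ γ) (ULoop3.polyakov 0 y) c := by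
  obtain ⟨y, hy, h⟩ := exists_canonical_polyakov F ℰ γ μ x
  exact ⟨y, hy, fun K => h K 2, fun c => uniformVariance_congr (fun K => h K 1) (fun K => h K 2)⟩

end Canonical

/-! ## 3. `SU(2)`: the margin and NT3 for every Polyakov label -/

section SU2

variable (F : T3Family) (ℰ : LoopAverage (Matrix.specialUnitaryGroup (Fin 2) ℂ)) {γ : ℝ} {r w w' : ℕ → ℝ}

/-- **`1/4 ≤ ⟨W̄_P · W̄_P⟩₀` FOR EVERY POLYAKOV LABEL** (`SU(2)`, any direction, any base point, any `ℰ`, `γ ≥ 0`). [cite: BorgsSeiler1983, §III.1 (III.23) p.347] -/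
theorem expectAt_zero_polyakov_pair_ge_all (hγ : 0 ≤ γ) (μ : Fin 3) (x : F.USite) :
    (1 : ℝ) / 4 ≤ (F.scheme ℰ γ).expectAt 0 [ULoop3.polyakov μ x, ULoop3.polyakov μ x] := by
  obtain ⟨y, hy, h2, -⟩ := exists_uniformVariance_polyakov_iff (F := F) (ℰ := ℰ) (γ := γ) μ x
  rw [h2 0]
  exact expectAt_zero_polyakov_pair_ge F ℰ hγ hy

variable {F ℰ}

/-- **NT3 FOR EVERY POLYAKOV LABEL, `SU(2)`**, smallness on the large-field masses only: `UnitTiltTail F ℰ γ r w w'` (summable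
non-negative rates, measurable `ℰ`, `γ ≥ 0`) and `c + Σ(w + w') ≤ e^{−2Σr}/4`, `0 < c` ⇒ `UniformVariance (F.scheme ℰ γ) (polyakov μ x) c`. [cite: Chatterjee2019YMProbabilists, §6 p.19] -/
theorem uniformVariance_polyakov_of_smallMass_all (hE : ℰ.MeasurableE) (hγ : 0 ≤ γ) (h : UnitTiltTail F ℰ γ r w w')
    (hr : Summable r) (hw : Summable w) (hw' : Summable w') (hr0 : ∀ K, 0 ≤ r K) (hw0 : ∀ K, 0 ≤ w K) (hw0' : ∀ K, 0 ≤ w' K)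
    (μ : Fin 3) (x : F.USite) {c : ℝ} (hc : 0 < c) (hsmall : c + ∑' i, (w i + w' i) ≤ Real.exp (-2 * ∑' i, r i) / 4) :
    UniformVariance (F.scheme ℰ γ) (ULoop3.polyakov μ x) c := by
  obtain ⟨y, hy, -, hiff⟩ := exists_uniformVariance_polyakov_iff (F := F) (ℰ := ℰ) (γ := γ) μ x
  exact (hiff c).mpr (uniformVariance_polyakov_of_smallMass hE hγ h hr hw hw' hr0 hw0 hw0' hy hc hsmall)

/-- The same with the additive transfer (smallness on the whole K1 ∧ K2 tail): `c + Σ(8r + 4w + 2w') ≤ 1/4`. [cite: Chatterjee2019YMProbabilists, §6 p.19] -/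
theorem uniformVariance_polyakov_of_unitTiltTail_all (hE : ℰ.MeasurableE) (hγ : 0 ≤ γ) (h : UnitTiltTail F ℰ γ r w w')
    (hr : Summable r) (hw : Summable w) (hw' : Summable w') (hr0 : ∀ K, 0 ≤ r K) (hw0 : ∀ K, 0 ≤ w K) (hw0' : ∀ K, 0 ≤ w' K)
    (μ : Fin 3) (x : F.USite) {c : ℝ} (hc : 0 < c) (hsmall : c + ∑' i, (8 * r i + 4 * w i + 2 * w' i) ≤ 1 / 4) :
    UniformVariance (F.scheme ℰ γ) (ULoop3.polyakov μ x) c := by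
  obtain ⟨y, hy, -, hiff⟩ := exists_uniformVariance_polyakov_iff (F := F) (ℰ := ℰ) (γ := γ) μ x
  exact (hiff c).mpr (uniformVariance_polyakov_of_unitTiltTail hE hγ h hr hw hw' hr0 hw0 hw0' hy hc hsmall)

end SU2

/-! ## 4. `SU(N)`, `N ≥ 3`: the margin and NT3 for every Polyakov label -/

section SUN

variable {N : ℕ} [NeZero N] (F : T3Family) (ℰ : LoopAverage (Matrix.specialUnitaryGroup (Fin N) ℂ)) {γ : ℝ} {r w w' : ℕ → ℝ}

/-- **`1/(2N²) ≤ ⟨W̄_P · W̄_P⟩₀` FOR EVERY POLYAKOV LABEL** (`SU(N)`, `N ≥ 3`, measurable `ℰ`, `γ ≥ 0`). [cite: BorgsSeiler1983, §III.1 (III.23) p.347] -/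
theorem expectAt_zero_polyakov_pair_ge_SU_all (hN : 3 ≤ N) (hE : ℰ.MeasurableE) (hγ : 0 ≤ γ) (μ : Fin 3) (x : F.USite) :
    1 / (2 * (N : ℝ) ^ 2) ≤ (F.scheme ℰ γ).expectAt 0 [ULoop3.polyakov μ x, ULoop3.polyakov μ x] := by
  obtain ⟨y, hy, h2, -⟩ := exists_uniformVariance_polyakov_iff (F := F) (ℰ := ℰ) (γ := γ) μ x
  rw [h2 0]
  exact expectAt_zero_polyakov_pair_ge_SU F ℰ hN hE hγ hy

variable {F ℰ}

/-- **NT3 FOR EVERY POLYAKOV LABEL, `SU(N)`, `N ≥ 3`**: `UnitTiltTail` (summable non-negative rates, measurable `ℰ`, `γ ≥ 0`) and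
`c + Σ(w + w') ≤ e^{−2Σr}/(2N²)`, `0 < c` ⇒ `UniformVariance (F.scheme ℰ γ) (polyakov μ x) c`. [cite: Chatterjee2019YMProbabilists, §6 p.19] -/
theorem uniformVariance_polyakov_of_smallMass_SU_all (hN : 3 ≤ N) (hE : ℰ.MeasurableE) (hγ : 0 ≤ γ)
    (h : UnitTiltTail F ℰ γ r w w') (hr : Summable r) (hw : Summable w) (hw' : Summable w') (hr0 : ∀ K, 0 ≤ r K)
    (hw0 : ∀ K, 0 ≤ w K) (hw0' : ∀ K, 0 ≤ w' K) (μ : Fin 3) (x : F.USite) {c : ℝ} (hc : 0 < c)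
    (hsmall : c + ∑' i, (w i + w' i) ≤ Real.exp (-2 * ∑' i, r i) / (2 * (N : ℝ) ^ 2)) :
    UniformVariance (F.scheme ℰ γ) (ULoop3.polyakov μ x) c := by
  obtain ⟨y, hy, -, hiff⟩ := exists_uniformVariance_polyakov_iff (F := F) (ℰ := ℰ) (γ := γ) μ x
  exact (hiff c).mpr (uniformVariance_polyakov_of_smallMass_SU hN hE hγ h hr hw hw' hr0 hw0 hw0' hy hc hsmall)

end SUN

end Literature.MathematicalPhysics.QuantumFieldTheory.Balaban1983to89.T3PolyakovCovariance

end
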